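import Mathlib.Data.List.Basic
import Mathlib.Data.Nat.Basic
import HarnessLib

/-!
# The growth-search checker for the finite census of gapped twelve-shells (computable part)

Topic `Literature/Geometry/DiscreteGeometry`; computational brick for the census half of the
crux `GappedShellCensus.ShellTrichotomy` (stub `stub_censusFinite` of line `Sketch`).
COMPUTABLE DEFINITIONS ONLY (nothing is asserted here).

The abstract input (`ShellCensusSearchSound.lean`, structure `CF`) is a closed fan surface on
twelve labels — twenty triangles (3-sets), two triangles on every side, single-cycle links —
carrying a 4-regular `bond` graph whose edges are sides and whose 3-cliques are triangles, in
which no label has one of the three DEAD stars (`4T`, `3T+Q`, `3T+2H`: the stars whose fan-angle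
budget is `< 2π` for a gapped shell).  The claim: up to relabelling, `bond` is the cuboctahedral,
the anticuboctahedral or the hexagonal-antiprism graph.

The checker works in TWO PHASES.  Phase 1 explores, by DISK GROWTH over open sides, every
labelled fan surface: the root is one triangle `{0,1,2}` at a label `0` of minimum star size
`m0 ∈ {4,5}` with `0–1` a bond; the second triangle on the first open side `{p,q}` has third
vertex an old label or the next new one; a label all of whose spokes carry two triangles is
CLOSED (its star is complete; prunes: star size `< m0`, `≠ m0` at the root; the star-size budget
`Σ m_v = 60`).  A closed-up surface with fewer than twenty triangles is vacuous (no structure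
contains it); on a complete one (twenty triangles, twelve labels) Phase 2 assigns the four bond
spokes of the labels `0, 1, …, 11` in turn among their links (branching), recording every other
pair at the label as a non-bond and two bond neighbours whose triangle with the label is not
placed as non-bonded (`bond_tri`); prunes: five bonds at a label, and the three dead stars as
soon as their flags are recorded.  A full assignment must be killed
by a dead star (or an unplaced bond 3-clique) or carried by a verified bijection onto one of the
three pattern graphs (`accept`).  Semantics and soundness: `ShellCensusSearchSound*.lean`;
the run (by `native_decide`, computational lane): `ShellCensusSearchRun*.lean`.
-/

namespace Literature.Geometry.DiscreteGeometry

namespace ShellCensusSearch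

/-! ### Codes -/

/-- Fold `f` over `lo, lo+1, …, lo+k-1`. [folklore] -/
def foldRange {β : Type} (f : β → ℕ → β) : ℕ → ℕ → β → β
  | _, 0, acc => acc
  | lo, k + 1, acc => foldRange f (lo + 1) k (f acc lo)

/-- Triangle code `256 a + 16 b + c`. [folklore] -/
def triCode (a b c : ℕ) : ℕ := 256 * a + 16 * b + c
/-- First vertex of a triangle code. [folklore] -/
def tv0 (t : ℕ) : ℕ := t / 256
/-- Second vertex. [folklore] -/
def tv1 (t : ℕ) : ℕ := (t / 16) % 16
/-- Third vertex. [folklore] -/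
def tv2 (t : ℕ) : ℕ := t % 16
/-- Whether `v` is a vertex of the triangle code `t`. [folklore] -/
def tmem (t v : ℕ) : Bool := tv0 t == v || tv1 t == v || tv2 t == v
/-- Sorted triangle code of three (distinct) labels. [folklore] -/
def sortTri (a b c : ℕ) : ℕ :=
  if a < b then (if b < c then triCode a b c else if a < c then triCode a c b else triCode c a b)
  else (if a < c then triCode b a c else if b < c then triCode b c a else triCode c b a)
/-- The two other vertices of a triangle code seen from `v`. [folklore] -/
def others (t v : ℕ) : ℕ × ℕ :=
  if tv0 t = v then (tv1 t, tv2 t) else if tv1 t = v then (tv0 t, tv2 t) else (tv0 t, tv1 t)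
/-- Side index of `{a, b}`. [folklore] -/
def sIdx (a b : ℕ) : ℕ := if a < b then 12 * a + b else 12 * b + a

/-! ### States -/

/-- A search state: number of used labels `n`, the root star size `m0`, the placed triangles
(codes), the bond flags (index `sIdx`; `0` unknown, `1` no bond, `2` bond) and the closed labels
(`cl[v] ≠ 0`). [folklore] -/
structure St where
  /-- used labels are `0 … n-1` -/
  n : ℕ
  /-- star size of the root label `0` (minimum over the structure) -/
  m0 : ℕ
  /-- placed triangles -/
  tris : Array ℕ
  /-- bond flags -/
  gb : Array ℕ
  /-- closed labels -/
  cl : Array ℕ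
  deriving Inhabited

/-- Side count of `{a, b}`: the number of placed triangles containing both labels (recomputed;
no cache, so that it is correct by definition). [folklore] -/
def St.gsc (s : St) (a b : ℕ) : ℕ := (s.tris.toList.filter fun t => tmem t a && tmem t b).length
/-- Bond flag of `{a, b}`. [folklore] -/
def St.ggb (s : St) (a b : ℕ) : ℕ := s.gb.getD (sIdx a b) 0
/-- Set the bond flag of `{a, b}`. [folklore] -/
def St.sgb (s : St) (a b f : ℕ) : St := { s with gb := s.gb.setIfInBounds (sIdx a b) f }
/-- Whether the label `v` is closed. [folklore] -/
def St.isCl (s : St) (v : ℕ) : Bool := s.cl.getD v 0 != 0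
/-- The placed triangles at `v`. [folklore] -/
def St.trisAt (s : St) (v : ℕ) : List ℕ := s.tris.foldr (fun t l => if tmem t v then t :: l else l) []
/-- The link labels of `v` (labels sharing a placed side with `v`). [folklore] -/
def St.link (s : St) (v : ℕ) : List ℕ := (List.range s.n).filter fun u => u != v && s.gsc v u != 0
/-- Every spoke at `v` carries two triangles (and there is one). [folklore] -/
def St.spokesTwo (s : St) (v : ℕ) : Bool :=
  !(s.link v).isEmpty && (s.link v).all fun u => s.gsc v u == 2
/-- Number of recorded bonds at `v`. [folklore] -/
def St.bdeg (s : St) (v : ℕ) : ℕ := ((List.range s.n).filter fun u => u != v && s.ggb v u == 2).length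
/-- Whether the (sorted) triangle `{a,b,c}` is placed. [folklore] -/
def St.placed (s : St) (a b c : ℕ) : Bool := s.tris.contains (sortTri a b c)
/-- Place the triangle `{p,q,r}` (code sorted). [folklore] -/
def St.addTri (s : St) (p q r : ℕ) : St := { s with tris := s.tris.push (sortTri p q r) }

/-! ### The star-size budget and the open side -/

/-- `v` has an open spoke (a side `{v,u}` with exactly one placed triangle). [folklore] -/
def St.hasOpen (s : St) (v : ℕ) : Bool := (List.range s.n).any fun u => u != v && s.gsc v u == 1

/-- Lower estimate of `Σ_v m_v` (`= 60` in a structure): a used label contributes its placed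
star size, `+ 1` if it has an open spoke, but at least `4`; an unused label `4`. [folklore] -/
def St.budget (s : St) : ℕ :=
  foldRange (fun acc v => acc + max 4 ((s.trisAt v).length + (if s.hasOpen v then 1 else 0))) 0 s.n 0 +
    4 * (12 - s.n)

/-- The first open side `{p, q}` (`p < q < n`, exactly one placed triangle), lexicographically.
[folklore] -/
def St.chooseOpen (s : St) : Option (ℕ × ℕ) :=
  (List.range s.n).findSome? fun p =>
    ((List.range s.n).find? fun q => decide (p < q) && s.gsc p q == 1).map fun q => (p, q)

/-! ### Closing a label -/

/-- Sublists of `L` of length `k`. [folklore] -/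
def choose : List ℕ → ℕ → List (List ℕ)
  | _, 0 => [[]]
  | [], _ + 1 => []
  | x :: xs, k + 1 => ((choose xs k).map fun l => x :: l) ++ choose xs (k + 1)

/-- Phase 2: record the flags at the label `v` whose bond partners are exactly `B ⊆ link v`:
spokes to `B` are bonds, every other pair at `v` is a non-bond; two bond partners whose
triangle with `v` is not placed are non-bonded (`none` on a recorded contradiction); then the
degree bound `≤ 4` at every label. [folklore] -/
def St.assignWith (s : St) (v : ℕ) (B : List ℕ) : Option St :=
  let s1 := foldRange (fun (s' : St) u =>
      if u = v then s' else if B.contains u then s'.sgb v u 2 else s'.sgb v u 1) 0 12 s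
  let s2 : Option St := B.foldl (fun (os : Option St) w1 => B.foldl (fun (os' : Option St) w2 =>
      match os' with
      | none => none
      | some s' =>
        if w1 < w2 ∧ !(s'.placed v w1 w2) then
          if s'.ggb w1 w2 = 2 then none else some (s'.sgb w1 w2 1)
        else some s') os) (some s1)
  match s2 with
  | none => none
  | some s' =>
    if (List.range 12).all (fun u => decide (s'.bdeg u ≤ 4)) then some s' else none

/-- A cyclic order of the link of `v` read off the placed triangles (heuristic: used only to
generate candidate patterns; `[]` if the walk fails). [folklore] -/
def St.linkCycle (s : St) (v : ℕ) : List ℕ :=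
  match s.trisAt v with
  | [] => []
  | t :: _ =>
    let m := (s.trisAt v).length
    let a := (others t v).1
    let b := (others t v).2
    -- walk: from (prev, cur) find the other triangle on {v, cur}
    let step : ℕ × ℕ → ℕ × ℕ := fun pc =>
      match (s.trisAt v).find? (fun t' => tmem t' pc.2 && !(tmem t' pc.1)) with
      | none => (pc.2, pc.2)
      | some t' =>
        let o := others t' v
        (pc.2, if o.1 = pc.2 then o.2 else o.1)
    (foldRange (fun (st : (ℕ × ℕ) × List ℕ) _ =>
        let pc' := step st.1
        (pc', st.2 ++ [pc'.2])) 0 (m - 2) ((a, b), [a, b])).2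

/-- The placed star of `v` is exactly the listed triangles. [folklore] -/
def St.starIs (s : St) (v : ℕ) (T : List ℕ) : Bool :=
  (s.trisAt v).all (fun t => T.contains t) && T.all (fun t => (s.trisAt v).contains t)

/-- Pairwise distinct labels `< 12`. [folklore] -/
def distinctLt (L : List ℕ) : Bool := L.all (fun x => decide (x < 12)) && decide L.Nodup

/-- **Dead star `4T`** at a closed `v` with link cycle `a b c d`, certified from recorded flags.
[folklore] -/
def St.kill4T (s : St) (v a b c d : ℕ) : Bool :=
  distinctLt [v, a, b, c, d] &&
  s.isCl v && s.starIs v [sortTri v a b, sortTri v b c, sortTri v c d, sortTri v d a] &&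
  s.ggb v a == 2 && s.ggb v b == 2 && s.ggb v c == 2 && s.ggb v d == 2 &&
  s.ggb a b == 2 && s.ggb b c == 2 && s.ggb c d == 2 && s.ggb d a == 2

/-- **Dead star `3T+Q`** at a closed `v` with link cycle `a b c d` (`d–a` the non-bond rim) and
quad witness `x`. [folklore] -/
def St.kill3TQ (s : St) (v a b c d x : ℕ) : Bool :=
  distinctLt [v, a, b, c, d, x] &&
  s.isCl v && s.starIs v [sortTri v a b, sortTri v b c, sortTri v c d, sortTri v d a] &&
  s.ggb v a == 2 && s.ggb v b == 2 && s.ggb v c == 2 && s.ggb v d == 2 &&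
  s.ggb a b == 2 && s.ggb b c == 2 && s.ggb c d == 2 && s.ggb d a == 1 && d != a &&
  s.ggb d x == 2 && s.ggb x a == 2 && s.ggb v x == 1 && x != v

/-- **Dead star `3T+2H`** at a closed `v` with link cycle `a b c d x` (`v–x` the non-bond spoke).
[folklore] -/
def St.kill3T2H (s : St) (v a b c d x : ℕ) : Bool :=
  distinctLt [v, a, b, c, d, x] &&
  s.isCl v && s.starIs v [sortTri v a b, sortTri v b c, sortTri v c d, sortTri v d x, sortTri v a x] &&
  s.ggb v a == 2 && s.ggb v b == 2 && s.ggb v c == 2 && s.ggb v d == 2 &&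
  s.ggb a b == 2 && s.ggb b c == 2 && s.ggb c d == 2 && s.ggb d x == 2 && s.ggb a x == 2 &&
  s.ggb v x == 1 && v != x

/-- Some dead star is certified at `v`: the link cycle is read off the placed triangles, the
recorded flags select the candidate pattern (and the quad witness), and the certified predicate
is evaluated on it. [folklore] -/
def St.killAt (s : St) (v : ℕ) : Bool :=
  if !(s.isCl v) then false
  else
    let C := s.linkCycle v
    let m := C.length
    if m = 4 then
      if !(C.all fun u => s.ggb v u == 2) then false
      else
        (List.range 4).any fun k =>
          let a := C.getD k 0
          let b := C.getD ((k + 1) % 4) 0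
          let c := C.getD ((k + 2) % 4) 0
          let d := C.getD ((k + 3) % 4) 0
          if s.ggb a b == 2 && s.ggb b c == 2 && s.ggb c d == 2 then
            if s.ggb d a == 2 then s.kill4T v a b c d
            else if s.ggb d a == 1 then
              (List.range s.n).any fun x =>
                s.ggb d x == 2 && s.ggb x a == 2 && s.ggb v x == 1 && s.kill3TQ v a b c d x
            else false
          else false
    else if m = 5 then
      (List.range 5).any fun k =>
        let a := C.getD k 0
        let b := C.getD ((k + 1) % 5) 0
        let c := C.getD ((k + 2) % 5) 0
        let d := C.getD ((k + 3) % 5) 0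
        let x := C.getD ((k + 4) % 5) 0
        s.ggb v x == 1 && s.ggb v a == 2 && s.ggb a b == 2 && s.ggb b c == 2 && s.ggb c d == 2 &&
          s.ggb d x == 2 && s.ggb a x == 2 && s.kill3T2H v a b c d x
    else false

/-- Phase 1: close the label `v` if all its spokes carry two triangles (prune: star size below
`m0`, or not exactly `m0` at the root label `0`). [folklore] -/
def St.closeOne (s : St) (v : ℕ) : Option St :=
  if s.isCl v || !(s.spokesTwo v) then some s
  else
    let m := (s.trisAt v).length
    if m < s.m0 ∨ (v = 0 ∧ m ≠ s.m0) then none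
    else some { s with cl := s.cl.setIfInBounds v 1 }

/-- Close, in turn, every label of the list that has become closable. [folklore] -/
def St.closeAll (s : St) : List ℕ → Option St
  | [] => some s
  | v :: rest =>
    match s.closeOne v with
    | none => none
    | some s' => s'.closeAll rest

/-! ### Leaves: the pattern graphs and the recogniser -/

/-- Adjacency of a complete leaf: a recorded bond. [folklore] -/
def St.adjB (s : St) (a b : ℕ) : Bool := a != b && s.ggb a b == 2

/-- The integer vectors of the cuboctahedral (fcc) pattern, scale `1` (squared bond `2`).
[folklore] -/
def fccV : List (ℤ × ℤ × ℤ) :=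
  [(1,1,0),(1,-1,0),(-1,1,0),(-1,-1,0),(1,0,1),(1,0,-1),(-1,0,1),(-1,0,-1),(0,1,1),(0,1,-1),(0,-1,1),(0,-1,-1)]
/-- The integer vectors of the anticuboctahedral (hcp) pattern, scale `3` (squared bond `18`).
[folklore] -/
def hcpV : List (ℤ × ℤ × ℤ) :=
  [(3,-3,0),(-3,3,0),(3,0,-3),(-3,0,3),(0,3,-3),(0,-3,3),(3,3,0),(3,0,3),(0,3,3),(-1,-1,-4),(-1,-4,-1),(-4,-1,-1)]
/-- Squared distance of two integer triples. [folklore] -/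
def sqd (a b : ℤ × ℤ × ℤ) : ℤ := (a.1 - b.1) ^ 2 + (a.2.1 - b.2.1) ^ 2 + (a.2.2 - b.2.2) ^ 2
/-- The 24 edges of the labelled hexagonal antiprism (`(min, max)` pairs). [folklore] -/
def apEdges : List (ℕ × ℕ) :=
  [(0, 1), (1, 2), (2, 3), (3, 4), (4, 5), (0, 5), (6, 7), (7, 8), (8, 9), (9, 10), (10, 11), (6, 11), (0, 6), (1, 7),
   (2, 8), (3, 9), (4, 10), (5, 11), (1, 6), (2, 7), (3, 8), (4, 9), (5, 10), (0, 11)]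
/-- The three pattern graphs: `0` = fcc, `1` = hcp, `2` = antiprism. [folklore] -/
def patAdj (i a b : ℕ) : Bool :=
  if i = 0 then a != b && sqd (fccV.getD a (0,0,0)) (fccV.getD b (0,0,0)) == 2
  else if i = 1 then a != b && sqd (hcpV.getD a (0,0,0)) (hcpV.getD b (0,0,0)) == 18
  else apEdges.contains (min a b, max a b)

/-- `perm` (twelve images) is a bijection carrying the pattern `i` onto the recorded bond graph:
`adjB (perm v) (perm w) = patAdj i v w`. [folklore] -/
def St.isoTo (s : St) (i : ℕ) (perm : List ℕ) : Bool :=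
  perm.length == 12 && perm.all (fun x => decide (x < 12)) &&
  (List.range 12).all (fun a => (List.range 12).all fun b => a == b || perm.getD a 12 != perm.getD b 12) &&
  (List.range 12).all fun a => (List.range 12).all fun b =>
    s.adjB (perm.getD a 12) (perm.getD b 12) == patAdj i a b

/-- Backtracking search for such a bijection. [folklore] -/
def St.findIso (s : St) (i : ℕ) : ℕ → List ℕ → Option (List ℕ)
  | 0, _ => none
  | fuel + 1, acc =>
    let k := acc.length
    if 12 ≤ k then (if s.isoTo i acc then some acc else none)
    else
      (List.range 12).findSome? fun img =>
        if acc.contains img then none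
        else
          let ok := (List.range k).all fun a => s.adjB (acc.getD a 12) img == patAdj i a k
          if ok then s.findIso i fuel (acc ++ [img]) else none

/-- Accept a complete leaf by a verified bijection onto one of the three patterns. [folklore] -/
def St.accept (s : St) : Bool :=
  (List.range 3).any fun i =>
    match s.findIso i 20 [] with
    | some p => s.isoTo i p
    | none => false

/-- A recorded bond 3-clique that is not a placed triangle (contradicts `bond_tri` at a complete
leaf). [folklore] -/
def St.cliqueNotPlaced (s : St) : Bool :=
  (List.range 12).any fun a => (List.range 12).any fun b => (List.range 12).any fun c =>
    decide (a < b) && decide (b < c) && s.adjB a b && s.adjB b c && s.adjB a c && !(s.placed a b c)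

/-! ### Growth and the search -/

/-- One level of the search tree. [folklore] -/
inductive Node
  /-- a decided node -/
  | leaf (b : Bool) : Node
  /-- an internal node -/
  | branch (kids : List St) : Node

/-- Phase 2 start on a complete surface: every label is closed, every non-side is a non-bond.
[folklore] -/
def St.initFlags (s : St) : St :=
  let g := foldRange (fun (g : Array ℕ) i =>
      let a := i / 12
      let b := i % 12
      if a < b ∧ s.gsc a b = 0 then g.setIfInBounds (sIdx a b) 1 else g) 0 144 s.gb
  { s with gb := g, cl := Array.replicate 12 1, n := 12 }

/-- Every pair of distinct labels carries a recorded flag. [folklore] -/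
def St.allFlagged (s : St) : Bool :=
  (List.range 12).all fun a => (List.range 12).all fun b => a == b || s.ggb a b != 0

/-- The final test of a full assignment: an unplaced bond 3-clique or a dead star (vacuous), else
all flags recorded and a verified bijection onto a pattern. [folklore] -/
def St.final (s : St) : Bool :=
  if s.cliqueNotPlaced then true
  else if (List.range 12).any (fun v => s.killAt v) then true
  else s.allFlagged && s.accept

/-- **Phase 2**: assign the four bond partners of the labels `v, v+1, …, 11` in turn (every
admissible 4-subset of the link containing the recorded bonds and avoiding the recorded
non-bonds), pruning recorded contradictions and dead stars; `true` iff every full assignment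
passes `final`. [folklore] -/
def St.assign (s : St) (v : ℕ) : ℕ → Bool
  | 0 => false
  | fuel + 1 =>
    if 12 ≤ v then s.final
    else
      let L := s.link v
      let must := L.filter fun u => s.ggb v u == 2
      let free := L.filter fun u => s.ggb v u == 0
      if 4 < must.length then true
      else
        (choose free (4 - must.length)).all fun ch =>
          match s.assignWith v (must ++ ch) with
          | none => true
          | some s' =>
            if (List.range (v + 1)).any (fun u => s'.killAt u) then true
            else s'.assign (v + 1) fuel

/-- **Phase 2 on a complete surface.** [folklore] -/
def St.bondPhase (s : St) : Bool := s.initFlags.assign 0 13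

/-- The child grown at the open side `{p, q}` through the third vertex `r` (`none` if pruned by
the budget or by a closing label). [folklore] -/
def St.kidsAt (s : St) (p q r : ℕ) : Option St :=
  let s' := s.addTri p q r
  let s'' : St := if r = s.n then { s' with n := s.n + 1 } else s'
  if 60 < s''.budget then none else s''.closeAll [p, q, r]

/-- **One level of Phase 1.**  No open side: a closed-up surface with fewer than twenty triangles
or twelve labels is vacuous, a complete one goes to Phase 2.  Otherwise grow at the first open
side `{p, q}` over every admissible third vertex (an old open label with room on both new sides,
the triangle not yet placed; or the next new label). [folklore] -/
def St.expand (s : St) : Node :=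
  match s.chooseOpen with
  | none => .leaf (if s.tris.size != 20 || s.n != 12 then true else s.bondPhase)
  | some (p, q) =>
    if 20 ≤ s.tris.size then .leaf true
    else if s.isCl p || s.isCl q then .leaf true
    else
      .branch
        ((((List.range s.n).filter fun r =>
            !(r == p || r == q || s.isCl r || s.placed p q r || 2 ≤ s.gsc p r || 2 ≤ s.gsc q r)).filterMap
            fun r => s.kidsAt p q r) ++
          (if s.n < 12 then (s.kidsAt p q s.n).toList else []))

/-- **The search**: `true` means every structure consistent with the state has, up to
relabelling, one of the three pattern bond graphs. [folklore] -/
def St.search (s : St) : ℕ → Bool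
  | 0 => false
  | fuel + 1 =>
    match s.expand with
    | .leaf b => b
    | .branch kids => kids.all fun s' => s'.search fuel

/-- **The root states** (`m0 = 4, 5`): labels `0, 1, 2`, the triangle `{0,1,2}`, the bond `0–1`.
[folklore] -/
def mkRoot (m0 : ℕ) : St :=
  { n := 3, m0 := m0, tris := #[triCode 0 1 2],
    gb := (Array.replicate 144 0).setIfInBounds (sIdx 0 1) 2,
    cl := Array.replicate 12 0 }

/-- All root states. [folklore] -/
def rootStates : List St := [mkRoot 4, mkRoot 5]

/-- Expand every node of a list one level (`none` if a leaf is `false`). [folklore] -/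
def stepAll : List St → Option (List St)
  | [] => some []
  | s :: rest =>
    match s.expand with
    | .leaf true => stepAll rest
    | .leaf false => none
    | .branch kids => (stepAll rest).map fun L => kids ++ L

/-- The frontier at depth `k`. [folklore] -/
def frontier (L : List St) : ℕ → Option (List St)
  | 0 => some L
  | k + 1 =>
    match stepAll L with
    | none => none
    | some L' => frontier L' k

/-- Attach indices. [folklore] -/
def indexed {α : Type} (L : List α) : List (ℕ × α) := (List.range L.length).zip L

/-- **Part `i` of `parts`** of the run: the frontier nodes at depth `depth` with index
`≡ i (mod parts)` are searched with fuel `fuel`. [folklore] -/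
def checkPart (depth parts i fuel : ℕ) : Bool :=
  match frontier rootStates depth with
  | none => false
  | some L => (indexed L).all fun p => p.1 % parts != i || p.2.search fuel

/-- The whole run in one piece. [folklore] -/
def checkAll (fuel : ℕ) : Bool := rootStates.all fun s => s.search fuel

end ShellCensusSearch

end Literature.Geometry.DiscreteGeometry
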